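import Summits.Ventures.HodgeRepro2.T5SU11RadialGreenPositivity
import Summits.Ventures.HodgeRepro2.T5SU11WeightedSpaceGroundStateOrder
import Summits.Ventures.HodgeRepro2.T5SU11KernelIteratedDerivative

/-!
# The composed kernels alternate in sign; the kernel increases with the spectral parameter

The kernel `K_λ(t, s)` of `G^I_λ` is negative (row 4xx) and the iterates of a non-negative source alternate in sign
(row 567), so the composed kernels `K_λ^{∘(n+1)}(t, s) = (G^I_λ)ⁿ K_λ(·, s)(t)` have the sign `(−1)^{n+1}`; with
`∂_μ K_μ^{∘(n+1)} = (n + 1) K_μ^{∘(n+2)}` (row 580) and `∂_λ K_λ^{∘(n+1)} = (2λ − 2)(n + 1) K_λ^{∘(n+2)}` (row 579) this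
gives the monotonicity of the composed kernels in the spectral parameter:

* `kernel_comp_sign` — **`(−1)^{n+1} K_λ^{∘(n+1)}(t, s) ≥ 0`**; `abs_kernel_comp_eq` — `|K_λ^{∘(n+1)}| = (−1)^{n+1} K_λ^{∘(n+1)}`;
* `kernel_comp_sign_monotoneOn_mu`, `kernel_comp_sign_monotoneOn_lam` — **`(−1)ⁿ K^{∘(n+1)}(t, s)` is non-decreasing in `μ`
  on `(−1, ∞)` and in `λ` on `(1, ∞)`**;
* `kernel_monotoneOn_mu`, `kernel_monotoneOn_lam` — **the kernel `K_λ(t, s) < 0` itself increases with `μ` and with `λ`**.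

Nothing is claimed about (N).

Blind lane: Mathlib + the HodgeRepro2 prefix only; no sorry; axioms ⊆ {propext, Classical.choice,
Quot.sound}.
-/

namespace Summit.Ventures.HodgeRepro2.T5SU11KernelCompositionSign

open Filter Topology MeasureTheory
open Set (Ioi Ioc)
open T5SU11Cartan T5SU11SphericalFunction T5SU11SphericalDecay T5SU11RadialGreenKernel T5SU11RadialGreenImproper
  T5SU11RadialGreenPositivity T5SU11WeightedSpaceGroundStateOrder T5SU11KernelCompositionDerivative
  T5SU11KernelIteratedDerivative T5SU11ResolventDerivativeMu

section measure

variable [MeasurableSpace Circle] [BorelSpace Circle]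

variable {s : ℝ} (hs : 0 < s)

/-- **The composed kernels alternate in sign**: `(−1)^{n+1} (G^I_λ)ⁿ K_λ(·, s)(t) ≥ 0` for every `λ > 1`, `n` and `t > 0`. -/
theorem kernel_comp_sign {lam : ℝ} (hlam : 1 < lam) (n : ℕ) {t : ℝ} (ht : 0 < t) :
    0 ≤ (-1 : ℝ) ^ (n + 1)
      * ((greenSolI (fun t => sph lam (hyp t)) (sphDecay lam))^[n] (fun r => sphGreenKernel lam r s)) t := by
  have hg0 : ∀ r, 0 < r → 0 ≤ (fun r => (-1 : ℝ) * sphGreenKernel lam r s) r := by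
    intro r hr
    have := sphGreenKernel_neg hlam (s := s) hr
    simp only
    linarith
  have h := iterate_sign_ground hlam hg0 n ht
  rw [iterate_const_mul] at h
  simp only at h
  have e : (-1 : ℝ) ^ (n + 1)
      * ((greenSolI (fun t => sph lam (hyp t)) (sphDecay lam))^[n] (fun r => sphGreenKernel lam r s)) t
      = (-1 : ℝ) ^ n
        * ((-1) * ((greenSolI (fun t => sph lam (hyp t)) (sphDecay lam))^[n] (fun r => sphGreenKernel lam r s)) t) := by
    rw [pow_succ]
    ring
  rw [e]
  exact h

/-- `|K_λ^{∘(n+1)}(t, s)| = (−1)^{n+1} K_λ^{∘(n+1)}(t, s)`. -/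
theorem abs_kernel_comp_eq {lam : ℝ} (hlam : 1 < lam) (n : ℕ) {t : ℝ} (ht : 0 < t) :
    |((greenSolI (fun t => sph lam (hyp t)) (sphDecay lam))^[n] (fun r => sphGreenKernel lam r s)) t|
      = (-1 : ℝ) ^ (n + 1)
        * ((greenSolI (fun t => sph lam (hyp t)) (sphDecay lam))^[n] (fun r => sphGreenKernel lam r s)) t := by
  rw [← abs_of_nonneg (kernel_comp_sign hlam n ht), abs_mul, abs_pow, abs_neg, abs_one, one_pow, one_mul]

include hs in
/-- **`(−1)ⁿ K_μ^{∘(n+1)}(t, s)` is non-decreasing in `μ` on `(−1, ∞)`**: its derivative `(−1)ⁿ (n + 1) K_μ^{∘(n+2)}(t, s)` is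
`≥ 0` (row 580 and the sign of `K^{∘(n+2)}`). -/
theorem kernel_comp_sign_monotoneOn_mu (n : ℕ) {t : ℝ} (ht : 0 < t) :
    MonotoneOn (fun μ => (-1 : ℝ) ^ n * ((greenSolI (fun t => sph (1 + Real.sqrt (μ + 1)) (hyp t))
      (sphDecay (1 + Real.sqrt (μ + 1))))^[n] (fun r => sphGreenKernel (1 + Real.sqrt (μ + 1)) r s)) t) (Ioi (-1)) := by
  refine monotoneOn_of_hasDerivWithinAt_nonneg (convex_Ioi (-1 : ℝ))
    (f' := fun μ => (-1 : ℝ) ^ n * ((n + 1 : ℕ) * ((greenSolI (fun t => sph (1 + Real.sqrt (μ + 1)) (hyp t))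
      (sphDecay (1 + Real.sqrt (μ + 1))))^[n + 1] (fun r => sphGreenKernel (1 + Real.sqrt (μ + 1)) r s)) t))
    ?_ ?_ ?_
  · intro μ hμ
    exact ((hasDerivAt_kernel_comp_mu hs n hμ ht).const_mul _).continuousAt.continuousWithinAt
  · rw [interior_Ioi]
    intro μ hμ
    exact ((hasDerivAt_kernel_comp_mu hs n hμ ht).const_mul _).hasDerivWithinAt
  · rw [interior_Ioi]
    intro μ hμ
    have h := kernel_comp_sign (s := s) (one_lt_one_add_sqrt hμ) (n + 1) ht
    have e : (-1 : ℝ) ^ (n + 1 + 1) = (-1) ^ n := by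
      rw [pow_succ, pow_succ]
      ring
    rw [e] at h
    have hn : (0 : ℝ) ≤ (n + 1 : ℕ) := Nat.cast_nonneg _
    calc (0 : ℝ) ≤ ((n + 1 : ℕ) : ℝ) * ((-1 : ℝ) ^ n * ((greenSolI (fun t => sph (1 + Real.sqrt (μ + 1)) (hyp t))
          (sphDecay (1 + Real.sqrt (μ + 1))))^[n + 1] (fun r => sphGreenKernel (1 + Real.sqrt (μ + 1)) r s)) t) :=
          mul_nonneg hn h
      _ = (-1 : ℝ) ^ n * ((n + 1 : ℕ) * ((greenSolI (fun t => sph (1 + Real.sqrt (μ + 1)) (hyp t))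
          (sphDecay (1 + Real.sqrt (μ + 1))))^[n + 1] (fun r => sphGreenKernel (1 + Real.sqrt (μ + 1)) r s)) t) := by
          ring

include hs in
/-- **`(−1)ⁿ K_λ^{∘(n+1)}(t, s)` is non-decreasing in `λ` on `(1, ∞)`**: its derivative `(2λ − 2)(n + 1)(−1)ⁿ K_λ^{∘(n+2)}(t, s)`
is `≥ 0` (row 579 and the sign of `K^{∘(n+2)}`). -/
theorem kernel_comp_sign_monotoneOn_lam (n : ℕ) {t : ℝ} (ht : 0 < t) :
    MonotoneOn (fun lam => (-1 : ℝ) ^ n * ((greenSolI (fun t => sph lam (hyp t)) (sphDecay lam))^[n]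
      (fun r => sphGreenKernel lam r s)) t) (Ioi 1) := by
  refine monotoneOn_of_hasDerivWithinAt_nonneg (convex_Ioi (1 : ℝ))
    (f' := fun lam => (-1 : ℝ) ^ n * ((2 * lam - 2) * ((n + 1 : ℕ) * ((greenSolI (fun t => sph lam (hyp t))
      (sphDecay lam))^[n + 1] (fun r => sphGreenKernel lam r s)) t)))
    ?_ ?_ ?_
  · intro lam hlam
    exact ((hasDerivAt_kernel_comp_lam hlam hs n ht).const_mul _).continuousAt.continuousWithinAt
  · rw [interior_Ioi]
    intro lam hlam
    exact ((hasDerivAt_kernel_comp_lam hlam hs n ht).const_mul _).hasDerivWithinAt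
  · rw [interior_Ioi]
    intro lam hlam
    have hlam' : (1 : ℝ) < lam := hlam
    have h := kernel_comp_sign (s := s) hlam' (n + 1) ht
    have e : (-1 : ℝ) ^ (n + 1 + 1) = (-1) ^ n := by
      rw [pow_succ, pow_succ]
      ring
    rw [e] at h
    have hn : (0 : ℝ) ≤ (n + 1 : ℕ) := Nat.cast_nonneg _
    have h2 : (0 : ℝ) ≤ 2 * lam - 2 := by linarith
    calc (0 : ℝ) ≤ (2 * lam - 2) * ((n + 1 : ℕ) : ℝ) * ((-1 : ℝ) ^ n
          * ((greenSolI (fun t => sph lam (hyp t)) (sphDecay lam))^[n + 1] (fun r => sphGreenKernel lam r s)) t) :=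
          mul_nonneg (mul_nonneg h2 hn) h
      _ = (-1 : ℝ) ^ n * ((2 * lam - 2) * ((n + 1 : ℕ) * ((greenSolI (fun t => sph lam (hyp t))
          (sphDecay lam))^[n + 1] (fun r => sphGreenKernel lam r s)) t)) := by
          ring

include hs in
/-- **The kernel increases with `μ`**: `μ ↦ K_{λ(μ)}(t, s)` is non-decreasing on `(−1, ∞)` (`∂_μ K = K ∘ K ≥ 0`). -/
theorem kernel_monotoneOn_mu {t : ℝ} (ht : 0 < t) :
    MonotoneOn (fun μ => sphGreenKernel (1 + Real.sqrt (μ + 1)) t s) (Ioi (-1)) := by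
  have h := kernel_comp_sign_monotoneOn_mu hs 0 ht
  simpa only [pow_zero, one_mul, Function.iterate_zero, id_eq] using h

include hs in
/-- **The kernel increases with `λ`**: `λ ↦ K_λ(t, s)` is non-decreasing on `(1, ∞)`. -/
theorem kernel_monotoneOn_lam {t : ℝ} (ht : 0 < t) :
    MonotoneOn (fun lam => sphGreenKernel lam t s) (Ioi 1) := by
  have h := kernel_comp_sign_monotoneOn_lam hs 0 ht
  simpa only [pow_zero, one_mul, Function.iterate_zero, id_eq] using h

end measure

end Summit.Ventures.HodgeRepro2.T5SU11KernelCompositionSign
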